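import Summits.QuantumFields.BalabanUV.T4Continuum.Support.NE3LocalReadoutsPair
import Summits.QuantumFields.BalabanUV.T4Continuum.Support.NE3HessShapes

/-!
# T⁴ programme, node NE3 — readings (D)∕(F), row S6-Z2 (P3 leaf L12 «READ-OUTS»), file 3: THE (D) READ-OUT FED BY ROAD P3's
# RELATIVE REPRESENTATION `RelRep` — `|L^{d−4}·A_Y(U_A) − A_{B(Y)}(U_B)| ≤ [β′-loc at U_B] + L^{d−4}·#(Y×planes)·(a_A·ε + 14ε²)`

NE3 formalisation swarm `b2b-balaban-t4-ne3-formalise-*` of the cell `pub-balaban`, unit `b2b-balaban-t4-ne3-formalise-leaf-01`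
(gen 2), row **S6-Z2** addendum to files 1–2 (`NE3LocalReadouts` p213867, `NE3LocalReadoutsPair` p214099).  Road P3's
`NE3HessShapes.RelRep U W P ε` (p214187; B11 Prop. 2 (19) TYPE: data `u`, `X` with `gaugeAct u W = vary U X 1`, `X` skew,
`‖X‖, ‖d_U X‖ ≤ ε`) carries EXACTLY the representation hypothesis `hrep` of file 2; THIS FILE plugs it in ([folklore]; 0 defs,
0 sorry): **`abs_twoLevel_windowAction_sub_le_of_relRep`** — for unitary `U_B` (`SmallField U_B a_B`, `512(d+1)(d+4)L²a_B ≤ 1`),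
unitary `U_A` (`SmallField U_A a_A`, `0 ≤ a_A`) and `r : RelRep U_A (rescale L (bavg L U_B)) P ε`:
`|L^{d−4}·A_Y(U_A) − A_{B(Y)}(U_B)| ≤ wallConstLoc·(a_B‖∇F‖_{ℓ¹} + ‖∇F‖²_{ℓ²} + a_B³#Y)(U_B, N_{2L}(B(Y))) + L^{d−4}·#(Y × planes)·(a_A·ε + 14ε²)`
(file 2 + `r.rep`, `r.skew`, `r.smallCurl`, `RelRep.sum_bondSq_le`).  The assembly Z0 supplies `r` (leaf L1) and T-LOC-P3's
LOCAL `ε`; nothing of that is asserted here.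

HONEST FRAMING.  Composition of landed lemmas about fixed configurations; `RelRep` is DATA supplied by the caller (asserted for
nothing); NE3 is NOT proved; `LocalRate` stays CONDITIONAL on T-LOC-P3; no printed sentence is a hypothesis; no `def`, no
`def … : Prop` fact, no `sorry`; axioms ⊆ {propext, Classical.choice, Quot.sound}; `BetaPertH`, (B), G-an2-4 occur nowhere.
Finite T⁴ rung (B)+1 — NOT infinite volume, NOT a mass gap, NOT the Clay problem; spine PROVED 0∕9.  HONEST DEPENDENCY (cell
page 1): continuum YM on T⁴ ⇐ BetaPertH ∧ nine spine estimates (0/9 proved); BetaPertH ⇐ (D1) ∧ (D4) ∧ CAP+tail; G-an2-4 gates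
asym, D1 and NE2/3/4.  PLACEMENT (human rule 2026-08-19): under `Summits/QuantumFields/BalabanUV/`.
-/

set_option autoImplicit false

open scoped BigOperators Matrix Matrix.Norms.L2Operator
open NormedSpace

namespace Summit.QuantumFields.BalabanUV.T4Continuum.NE3LocalReadoutsRelRep

open Literature.MathematicalPhysics.QuantumFieldTheory.Balaban1983to89
open B7Prop1Explicit B7Prop2Explicit MatrixLog UnitaryModel
open T4AveragingDeficitWall hiding Site Plane Plaq Bond
open T4AveragingDeficitWallBoundary (gradFluxL1)
open T4AveragingDeficitNonAbelian (wallConstLoc)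
open NE3HessBounds (bondSq)
open NE3HessShapes (RelRep)
open NE3LocalReadoutsPair (abs_twoLevel_windowAction_sub_le_of_smallField)

noncomputable section

variable {d : ℕ} {n : Type*} [Fintype n] [DecidableEq n] [Nonempty n]

/-- **THE (D) TWO-LEVEL READ-OUT FED BY A `RelRep`** (see the module docstring). [folklore] -/
theorem abs_twoLevel_windowAction_sub_le_of_relRep (L : ℕ) (hL : 1 ≤ L) {UB UA : Site d → Fin d → (Matrix n n ℂ)ˣ}
    (hUB : IsUnitaryCfg UB) (hUA : IsUnitaryCfg UA) {aB aA : ℝ} (haB : 0 ≤ aB) (haA : 0 ≤ aA)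
    (hsmall : 512 * (d + 1) * (d + 4) * (L : ℝ) ^ 2 * aB ≤ 1) (hUBa : SmallField UB aB) (hUAa : SmallField UA aA)
    {P : ℤ} {ε : ℝ} (r : RelRep UA (rescale L (bavg L UB)) P ε) (Y : Finset (Site d)) :
    |(L : ℝ) ^ ((d : ℤ) - 4) * fineAction UA (Y ×ˢ Finset.univ) - fineAction UB (blockSites L Y ×ˢ Finset.univ)|
      ≤ wallConstLoc d L * (aB * gradFluxL1 UB (nbhd (2 * L) (blockSites L Y))
            + gradFluxSq UB (nbhd (2 * L) (blockSites L Y)) + aB ^ 3 * Y.card)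
        + (L : ℝ) ^ ((d : ℤ) - 4)
            * (((Y ×ˢ (Finset.univ : Finset (T4AveragingDeficitWall.Plane d))).card : ℝ) * (aA * ε + 14 * ε ^ 2)) := by
  set W : Finset (T4AveragingDeficitWall.Plaq d) := Y ×ˢ Finset.univ with hW
  have h := abs_twoLevel_windowAction_sub_le_of_smallField L hL hUB hUA haB hsmall hUBa hUAa r.skew (u := r.u) r.rep Y
  -- the two sums against the `RelRep` sup data
  have hcurl : ∑ p ∈ W, ‖curl UA r.X p‖ ≤ (W.card : ℝ) * ε := by
    have hs := Finset.sum_le_card_nsmul W (fun p => ‖curl UA r.X p‖) ε fun p _ => r.smallCurl p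
    rwa [nsmul_eq_mul] at hs
  have hbond : ∑ p ∈ W, bondSq r.X p ≤ 4 * W.card * ε ^ 2 := RelRep.sum_bondSq_le r W
  have hw : 0 ≤ (L : ℝ) ^ ((d : ℤ) - 4) := zpow_nonneg (Nat.cast_nonneg L) _
  have hinner : aA * ∑ p ∈ W, ‖curl UA r.X p‖ + 7 / 2 * ∑ p ∈ W, bondSq r.X p ≤ (W.card : ℝ) * (aA * ε + 14 * ε ^ 2) := by
    have h1 : aA * ∑ p ∈ W, ‖curl UA r.X p‖ ≤ aA * ((W.card : ℝ) * ε) := mul_le_mul_of_nonneg_left hcurl haA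
    nlinarith
  exact h.trans (add_le_add le_rfl (mul_le_mul_of_nonneg_left hinner hw))

end

end Summit.QuantumFields.BalabanUV.T4Continuum.NE3LocalReadoutsRelRep
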